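import Mathlib.Analysis.InnerProductSpace.PiL2
import Mathlib.MeasureTheory.Integral.Bochner.Set
import Mathlib.MeasureTheory.Measure.Haar.InnerProductSpace
import Mathlib.MeasureTheory.Function.Floor
import Mathlib.MeasureTheory.Function.LpSpace.Basic
import Literature.MathematicalPhysics.QuantumFieldTheory.Balaban1983to89.B4Eq19LatticeOperators
import HarnessLib

/-!
# LINE 25 «CompactnessTransfer» (crux `HistoryTailL` stmt-QuantumFields-19936 ∕ K2 crux `BlockLipschitzL` stmt-QuantumFields-23533), S2′ infrastructure (Γ1),
# FILE B: THE PIECEWISE-CONSTANT BLOW-DOWN AND ITS CELLS — `x ↦ g(⌊R·x⌋)` on `EuclideanSpace ℝ (Fin 3)`: measurability, the half-open cells `{⌊R x⌋ = y}`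
# (volume `R⁻³`), square-integrability of bounded blow-downs, and ★ `∫_D g(⌊R x⌋) ≤ R⁻³ · Σ_{y ∈ L} g y` whenever `⌊R·D⌋ ⊆ L`

Cell `ym3-torus` (YM ladder rung R3 = continuum SU(2) Yang–Mills on the three-torus — a RUNG, NOT the Clay problem: not d = 4, not infinite volume, not a mass gap);
width seat `ym3-torus-px3` gen 7, the Γ1 seat (LEAD ym-ust-19936-w1 g9 11:10:54Z; ★★OWNER g30 STAGE 0; architecture = px14 g5 LOCATE «Γ1 without Kolmogorov–Riesz»).
THEOREMS ONLY (def-free); `--supports` the K2 crux as a helper.  Nothing here proves Γ1, S2′, the organ `hImproveCoreFlat`, `BlockLipschitzL`, `HistoryTailL` or any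
summit statement.

WHY.  Γ1-PC (SIGNATURE-0 `blowDown_L2_compact`, HOME 093526177ac80f17) blows the unit lattice maps `u k` down to the open unit cube by the PIECEWISE-CONSTANT map
`x ↦ u k (z k + ⌊R k · x⌋)`.  Every continuum quantity of the proof is an integral of such a function over a box; this file turns those integrals into finite lattice
sums: the cube `{x | ∀ i, ⌊R xᵢ⌋ = yᵢ}` is the half-open cell `Π_i [yᵢ∕R, (yᵢ+1)∕R)` of volume `R⁻³` (w7 g13's ✓`PoincareLipschitzSamplingCells.volume_real_cell` is the OPEN
cell; the half-open ones PARTITION space, which is what the counting needs), the blow-down of any `g : ℤ³ → β` is measurable (`Int.measurable_floor`, countable source),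
bounded blow-downs are in `L²` of any finite-measure set, and — the one inequality FILE C sums over dyadic cubes — for `g ≥ 0` and any measurable `D` whose floor-image
lies in a finite `L ⊆ ℤ³`, `∫_D g(⌊R x⌋) dx ≤ R⁻³ Σ_{y ∈ L} g y`.
* §1 `measurable_floorVec`, `measurable_comp_floorVec`, `aestronglyMeasurable_comp_floorVec`.
* §2 cells: `floorCell_eq_preimage_pi`, `measurableSet_floorCell`, ★ `volume_floorCell` (`= ofReal (R⁻¹)^3`), `volume_real_floorCell`, `mem_floorCell_self`.
* §3 ★ `setIntegral_comp_floorVec_le_sum` — `∫_D g(⌊R x⌋) ≤ R⁻³ · Σ_{y ∈ L} g y`.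
* §4 `memLp_comp_floorVec_of_bound` — bounded blow-downs are in `L^p(D)` for `volume D < ∞`; `integrable_comp_floorVec_of_bound`.
[folklore] ([AlicandroCicalese2008] §2 (piecewise-constant interpolation of lattice spin fields); the statements and proofs are elementary measure theory).
-/

set_option autoImplicit false

noncomputable section

open scoped BigOperators ENNReal
open MeasureTheory Set Finset Filter Topology

namespace Summit.QuantumFields.YangMills.Theorems.PoincareLipschitzBlowDownCells

open Literature.MathematicalPhysics.QuantumFieldTheory.Balaban1983to89
open B4Eq19LatticeOperators (Zd box unitVec)

/-! ## §1 Measurability of the blow-down -/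

/-- The coordinate map `x ↦ xᵢ` on `EuclideanSpace ℝ (Fin 3)` is measurable. [folklore] -/
theorem measurable_coord (i : Fin 3) : Measurable fun x : EuclideanSpace ℝ (Fin 3) => x i :=
  (EuclideanSpace.proj i).continuous.measurable

/-- The floor-vector `x ↦ (⌊R·xᵢ⌋)_i : EuclideanSpace ℝ (Fin 3) → ℤ³` is measurable. [folklore] -/
theorem measurable_floorVec (R : ℝ) : Measurable fun x : EuclideanSpace ℝ (Fin 3) => (fun i => ⌊R * x i⌋ : Zd 3) :=
  measurable_pi_iff.2 fun i => Int.measurable_floor.comp (measurable_const.mul (measurable_coord i))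

/-- The blow-down `x ↦ g(⌊R·x⌋)` of ANY lattice function is measurable (countable source). [folklore] -/
theorem measurable_comp_floorVec {β : Type*} [MeasurableSpace β] (g : Zd 3 → β) (R : ℝ) :
    Measurable fun x : EuclideanSpace ℝ (Fin 3) => g (fun i => ⌊R * x i⌋) :=
  (measurable_of_countable g).comp (measurable_floorVec R)

/-- The blow-down of a lattice map into a second-countable normed space is a.e.-strongly measurable for every measure. [folklore] -/
theorem aestronglyMeasurable_comp_floorVec {E : Type*} [NormedAddCommGroup E] [MeasurableSpace E] [BorelSpace E] [SecondCountableTopology E]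
    (g : Zd 3 → E) (R : ℝ) (μ : Measure (EuclideanSpace ℝ (Fin 3))) :
    AEStronglyMeasurable (fun x : EuclideanSpace ℝ (Fin 3) => g (fun i => ⌊R * x i⌋)) μ :=
  (measurable_comp_floorVec g R).aestronglyMeasurable

/-! ## §2 The half-open cells `{⌊R x⌋ = y}` -/

/-- For `R > 0`: `⌊R·xᵢ⌋ = yᵢ` for all `i` iff `x ∈ Π_i [yᵢ∕R, (yᵢ+1)∕R)`. [folklore] -/
theorem floorCell_eq_preimage_pi {R : ℝ} (hR : 0 < R) (y : Zd 3) :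
    {x : EuclideanSpace ℝ (Fin 3) | ∀ i, ⌊R * x i⌋ = y i}
      = (WithLp.ofLp : EuclideanSpace ℝ (Fin 3) → (Fin 3 → ℝ)) ⁻¹'
          (Set.pi Set.univ fun i => Set.Ico ((y i : ℝ) / R) (((y i : ℝ) + 1) / R)) := by
  ext x
  simp only [Set.mem_setOf_eq, Set.mem_preimage, Set.mem_pi, Set.mem_univ, true_implies, Set.mem_Ico]
  refine forall_congr' fun i => ?_
  rw [Int.floor_eq_iff, div_le_iff₀ hR, lt_div_iff₀ hR, mul_comm (x i) R]

/-- The cell `{⌊R x⌋ = y}` is measurable. [folklore] -/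
theorem measurableSet_floorCell (R : ℝ) (y : Zd 3) : MeasurableSet {x : EuclideanSpace ℝ (Fin 3) | ∀ i, ⌊R * x i⌋ = y i} := by
  have : {x : EuclideanSpace ℝ (Fin 3) | ∀ i, ⌊R * x i⌋ = y i} = (fun x : EuclideanSpace ℝ (Fin 3) => (fun i => ⌊R * x i⌋ : Zd 3)) ⁻¹' {y} := by
    ext x; simp only [Set.mem_setOf_eq, Set.mem_preimage, Set.mem_singleton_iff]; exact ⟨fun h => funext h, fun h i => congrFun h i⟩
  rw [this]
  exact measurable_floorVec R (MeasurableSet.singleton y)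

/-- ★ **The cell has volume `R⁻³`**: `volume {⌊R x⌋ = y} = ofReal (R⁻¹) ^ 3` (`R > 0`). [folklore] -/
theorem volume_floorCell {R : ℝ} (hR : 0 < R) (y : Zd 3) :
    volume {x : EuclideanSpace ℝ (Fin 3) | ∀ i, ⌊R * x i⌋ = y i} = ENNReal.ofReal R⁻¹ ^ 3 := by
  rw [floorCell_eq_preimage_pi hR y, (PiLp.volume_preserving_ofLp (Fin 3)).measure_preimage
    (MeasurableSet.univ_pi fun i => measurableSet_Ico).nullMeasurableSet, Real.volume_pi_Ico]
  have hdiff : ∀ i : Fin 3, ((y i : ℝ) + 1) / R - (y i : ℝ) / R = R⁻¹ := fun i => by field_simp; ring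
  simp only [hdiff, Finset.prod_const, Finset.card_univ, Fintype.card_fin]

/-- The cell volume as a real number: `R⁻³`; in particular it is finite. [folklore] -/
theorem volume_real_floorCell {R : ℝ} (hR : 0 < R) (y : Zd 3) :
    (volume {x : EuclideanSpace ℝ (Fin 3) | ∀ i, ⌊R * x i⌋ = y i}).toReal = R⁻¹ ^ 3 := by
  rw [volume_floorCell hR y, ENNReal.toReal_pow, ENNReal.toReal_ofReal (inv_nonneg.2 hR.le)]

/-- The cell volume is finite. [folklore] -/
theorem volume_floorCell_lt_top {R : ℝ} (hR : 0 < R) (y : Zd 3) :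
    volume {x : EuclideanSpace ℝ (Fin 3) | ∀ i, ⌊R * x i⌋ = y i} < ∞ := by
  rw [volume_floorCell hR y]
  exact ENNReal.pow_lt_top ENNReal.ofReal_lt_top

/-! ## §3 ★ Integrals of blow-downs over a box are dominated by lattice sums -/

/-- On a set whose floor-image lies in the finite set `L`, the blow-down of `g` is the finite sum of the cell indicators weighted by `g`. [folklore] -/
theorem comp_floorVec_eq_sum_indicator {β : Type*} [AddCommMonoid β] (g : Zd 3 → β) (R : ℝ) (L : Finset (Zd 3))
    {x : EuclideanSpace ℝ (Fin 3)} (hx : (fun i => ⌊R * x i⌋ : Zd 3) ∈ L) :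
    g (fun i => ⌊R * x i⌋) = ∑ y ∈ L, Set.indicator {x' : EuclideanSpace ℝ (Fin 3) | ∀ i, ⌊R * x' i⌋ = y i} (fun _ => g y) x := by
  classical
  rw [Finset.sum_eq_single_of_mem (fun i => ⌊R * x i⌋ : Zd 3) hx]
  · rw [Set.indicator_of_mem]; exact fun i => rfl
  · intro y _ hy
    rw [Set.indicator_of_notMem]
    intro h
    exact hy (funext fun i => (h i).symm)

/-- ★ **`∫_D g(⌊R x⌋) dx ≤ R⁻³ · Σ_{y ∈ L} g y`** for `g ≥ 0`, `R > 0`, `D` measurable and `⌊R·D⌋ ⊆ L` (each cell meets `D` in volume `≤ R⁻³`). [folklore]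
[cite: AlicandroCicalese2008, §2 (piecewise-constant interpolation)] -/
theorem setIntegral_comp_floorVec_le_sum {R : ℝ} (hR : 0 < R) {D : Set (EuclideanSpace ℝ (Fin 3))} (hD : MeasurableSet D)
    (L : Finset (Zd 3)) (hL : ∀ x ∈ D, (fun i => ⌊R * x i⌋ : Zd 3) ∈ L) (g : Zd 3 → ℝ) (hg : ∀ y, 0 ≤ g y) :
    ∫ x in D, g (fun i => ⌊R * x i⌋) ≤ R⁻¹ ^ 3 * ∑ y ∈ L, g y := by
  classical
  -- rewrite the integrand as the finite sum of weighted cell indicators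
  have hcongr : ∫ x in D, g (fun i => ⌊R * x i⌋)
      = ∫ x in D, ∑ y ∈ L, Set.indicator {x' : EuclideanSpace ℝ (Fin 3) | ∀ i, ⌊R * x' i⌋ = y i} (fun _ => g y) x :=
    setIntegral_congr_fun hD fun x hx => comp_floorVec_eq_sum_indicator g R L (hL x hx)
  rw [hcongr, integral_finsetSum]
  · rw [Finset.mul_sum]
    refine Finset.sum_le_sum fun y _ => ?_
    rw [integral_indicator (measurableSet_floorCell R y), setIntegral_const, smul_eq_mul]
    have hmono : (volume.restrict D).real {x' : EuclideanSpace ℝ (Fin 3) | ∀ i, ⌊R * x' i⌋ = y i} ≤ R⁻¹ ^ 3 := by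
      rw [measureReal_def, Measure.restrict_apply (measurableSet_floorCell R y), ← volume_real_floorCell hR y]
      exact ENNReal.toReal_mono (volume_floorCell_lt_top hR y).ne (measure_mono Set.inter_subset_left)
    exact mul_le_mul_of_nonneg_right hmono (hg y)
  · intro y _
    refine IntegrableOn.integrable_indicator ?_ (measurableSet_floorCell R y)
    refine (integrableOn_const_iff (C := g y)).2 (Or.inr ?_)
    rw [Measure.restrict_apply (measurableSet_floorCell R y)]
    exact (measure_mono Set.inter_subset_left).trans_lt (volume_floorCell_lt_top hR y)


/-! ## §4 Bounded blow-downs are in `L^p` of finite-measure sets -/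

/-- A bounded blow-down is in `L^p(D)` for every `p` and every set `D` of finite volume. [folklore] -/
theorem memLp_comp_floorVec_of_bound {E : Type*} [NormedAddCommGroup E] [MeasurableSpace E] [BorelSpace E] [SecondCountableTopology E]
    (g : Zd 3 → E) (R : ℝ) {C : ℝ} (hg : ∀ y, ‖g y‖ ≤ C) {D : Set (EuclideanSpace ℝ (Fin 3))} (hD : volume D < ∞) (p : ℝ≥0∞) :
    MemLp (fun x : EuclideanSpace ℝ (Fin 3) => g (fun i => ⌊R * x i⌋)) p (volume.restrict D) := by
  haveI : IsFiniteMeasure (volume.restrict D) := ⟨by rwa [Measure.restrict_apply_univ]⟩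
  exact MemLp.of_bound (aestronglyMeasurable_comp_floorVec g R _) C (Filter.Eventually.of_forall fun x => hg _)

/-- A bounded real blow-down is integrable on every set of finite volume. [folklore] -/
theorem integrableOn_comp_floorVec_of_bound (g : Zd 3 → ℝ) (R : ℝ) {C : ℝ} (hg : ∀ y, ‖g y‖ ≤ C)
    {D : Set (EuclideanSpace ℝ (Fin 3))} (hD : volume D < ∞) :
    IntegrableOn (fun x : EuclideanSpace ℝ (Fin 3) => g (fun i => ⌊R * x i⌋)) D volume :=
  memLp_one_iff_integrable.1 (memLp_comp_floorVec_of_bound g R hg hD 1)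

end Summit.QuantumFields.YangMills.Theorems.PoincareLipschitzBlowDownCells

end
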